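import Mathlib.NumberTheory.Padics.Hensel
import Mathlib.NumberTheory.Padics.RingHoms
import Mathlib.Data.ZMod.Units
import Mathlib.FieldTheory.Finite.Basic
import Mathlib.Data.Set.Card
import HarnessLib

/-!
# Route `ByReductionTypeAtTwo`, crux `MultUpperHalfAtTwo` (item stmt-BirchSwinnertonDyer-19922), TOWER road, the
# «ONE BIT AT A NON-SPLIT 2» rows: KERNEL BRICK 12 — `2`-adic units: `2^m`-th powers by Hensel, the residue of
# `u^{2^{m-1}·a}` for `u ≡ ±3 (mod 8)`, and the index-`2^m` subgroup `⟨2⟩ · ±(1 + 2^{m+2}ℤ₂)` of `ℚ₂ˣ`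

HONEST FRAMING (cell `bsd-2adic`, run/shared/lean/pub/bsd-2adic/, seat `bsd-2adic-tower-1` GEN 9, HUMAN RULINGS
D-0036 / D-0054 / D-0074): TOOL theorems only (no definition, no named fact, no `sorry`); closes nothing by itself;
nothing booked; BSD is not proved by any of this. Part of the KERNELISATION of the displayed MEMO binder
`MultTowerNS2.localTowerKerTwoTorsion_le_two_nonsplitTwo_of_tateUnit` (scope memo HOME/tower/SCOPE-hNS2one-kernel-GEN8.md,
step S5 in the GEN 9 form «the norm group of the `m`-th local layer `ℚ_{2,m} = ℚ₂(ζ_{2^{m+2}} + ζ⁻¹)` is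
`⟨2⟩ · ±(1 + 2^{m+2}ℤ₂)`, and `q^{2^{m-1} a} = (2^k u)^{2^{m-1} a}`, `u ≡ ±3 (mod 8)`, `a` odd, is not in it»).
This file is the `2`-adic arithmetic of that statement, in `ℤ_[2]` / `ℚ_[2]`:

* `exists_pow_two_pow_eq_of_toZModPow_eq_one` — **`1 + 2^{m+2}ℤ₂ ⊆ (ℤ₂ˣ)^{2^m}`**: an element `≡ 1 (mod 2^{m+2})`
  is a `2^m`-th power (Hensel's lemma for `X² − w` at `1`, Mathlib `hensels_lemma`, and induction on `m`);
* `toZModPow_pow_two_pow_mul_of_tateUnit` — for `u ≡ 3, 5 (mod 8)`, `a` odd, `m ≥ 1`: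
  `u^{2^{m-1} a} ≡ ±(1 + 2^{m+1}) (mod 2^{m+2})`, hence (`toZModPow_pow_ne_one_and_ne_neg_one_of_tateUnit`)
  `u^{2^{m-1} a} ≢ ±1 (mod 2^{m+2})`;
* `exists_subgroup_twoAdicLayerNorm` — the subgroup `T_m = {2^j w : j ∈ ℤ, w ∈ ℤ₂ˣ, w ≡ ±1 (mod 2^{m+2})}`
  of `ℚ₂ˣ` exists (stated by its membership predicate) and has index `2^m`.

References: J. Neukirch, *ANT* II (4.6), (5.7), V (1.1); J.-P. Serre, *A Course in Arithmetic*, II §3; scope memo S5.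
-/

set_option autoImplicit false
-- the Theorems namespace of this sub repeats the summit name by design (D-0017 nested layout: Summit.<S>.<Sub>)
set_option linter.dupNamespace false

noncomputable section

open scoped Classical

namespace Summit.BirchSwinnertonDyer.BirchSwinnertonDyer.Theorems.MultTowerNS2

open PadicInt Polynomial

/-! ### `toZModPow n x = toZModPow n y` as a norm inequality -/

/-- `x ≡ y (mod 2^n)` in `ℤ₂` iff `‖x − y‖ ≤ 2^{−n}`. [folklore] -/
theorem toZModPow_eq_iff_norm_sub_le (n : ℕ) (x y : ℤ_[2]) :
    toZModPow n x = toZModPow n y ↔ ‖x - y‖ ≤ (2 : ℝ) ^ (-(n : ℤ)) := by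
  rw [← sub_eq_zero, ← map_sub, ← RingHom.mem_ker, ker_toZModPow, ← norm_le_pow_iff_mem_span_pow]
  norm_num

/-- `‖2‖ = 2⁻¹` in `ℤ₂`. [folklore] -/
theorem norm_two_padicInt : ‖(2 : ℤ_[2])‖ = (2 : ℝ)⁻¹ := by
  have h : ‖((2 : ℕ) : ℤ_[2])‖ = ((2 : ℕ) : ℝ)⁻¹ := norm_p
  simpa using h
/-! ### Hensel: `1 + 8ℤ₂ ⊆ ℤ₂²`, and `1 + 2^{m+2}ℤ₂ ⊆ (ℤ₂)^{2^m}` -/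

/-- **An element of `ℤ₂` congruent to `1 mod 8` is a square**, with a square root `≡ 1 (mod 4)`
(Hensel's lemma for `X² − w` at `a = 1`: `‖1 − w‖ ≤ 1/8 < ‖2‖² = 1/4`). [cite: NeukirchANT1999, Ch. II (5.7) and Lemma (4.6) (Hensel)] -/
theorem exists_sq_eq_of_toZModPow_three_eq_one {w : ℤ_[2]} (hw : toZModPow 3 w = 1) :
    ∃ z : ℤ_[2], z ^ 2 = w ∧ ‖z - 1‖ < ‖(2 : ℤ_[2])‖ := by
  have hw1 : ‖w - 1‖ ≤ (2 : ℝ) ^ (-(3 : ℤ)) := by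
    have h := (toZModPow_eq_iff_norm_sub_le 3 w 1).mp (by rw [hw, map_one])
    exact_mod_cast h
  set F : ℤ_[2][X] := X ^ 2 - C w with hF
  have hFa : F.aeval (1 : ℤ_[2]) = 1 - w := by
    rw [hF]; simp
  have hF' : F.derivative.aeval (1 : ℤ_[2]) = 2 := by
    rw [hF, derivative_sub, derivative_X_pow, derivative_C]; simp
  have hnorm : ‖F.aeval (1 : ℤ_[2])‖ < ‖F.derivative.aeval (1 : ℤ_[2])‖ ^ 2 := by
    rw [hFa, hF', norm_two_padicInt, norm_sub_rev]
    refine hw1.trans_lt ?_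
    norm_num
  obtain ⟨z, hz, hz1, -, -⟩ := hensels_lemma hnorm
  refine ⟨z, ?_, ?_⟩
  · have h : z ^ 2 - w = 0 := by
      have := hz
      rw [hF] at this
      simpa using this
    exact sub_eq_zero.mp h
  · rw [hF'] at hz1
    exact hz1

/-- If `z ≡ 1 (mod 4)` then `‖z² − 1‖ = ‖z − 1‖ · ‖2‖` (`z + 1 = 2·unit`). [folklore] -/
theorem norm_sq_sub_one_of_norm_sub_one_lt {z : ℤ_[2]} (hz : ‖z - 1‖ < ‖(2 : ℤ_[2])‖) :
    ‖z ^ 2 - 1‖ = ‖z - 1‖ * ‖(2 : ℤ_[2])‖ := by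
  have hfac : z ^ 2 - 1 = (z - 1) * (z + 1) := by ring
  have hz1 : ‖z + 1‖ = ‖(2 : ℤ_[2])‖ := by
    have h : z + 1 = (z - 1) + 2 := by ring
    rw [h]
    rw [PadicInt.norm_add_eq_max_of_ne (ne_of_lt hz), max_eq_right hz.le]
  rw [hfac, norm_mul, hz1]

/-- **`1 + 2^{m+2}ℤ₂ ⊆ (ℤ₂)^{2^m}`**: every `w ≡ 1 (mod 2^{m+2})` in `ℤ₂` is a `2^m`-th power (induction on
`m`: a square root `z ≡ 1 (mod 4)` of `w ≡ 1 (mod 2^{m+3})` has `‖z − 1‖ = ‖w − 1‖/‖2‖ ≤ 2^{−(m+2)}`).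
[folklore] -/
theorem exists_pow_two_pow_eq_of_toZModPow_eq_one (m : ℕ) {w : ℤ_[2]} (hw : toZModPow (m + 2) w = 1) :
    ∃ w₀ : ℤ_[2], w₀ ^ 2 ^ m = w := by
  induction m generalizing w with
  | zero => exact ⟨w, by simp⟩
  | succ m ih =>
    -- `w ≡ 1 (mod 8)`: a square root `z ≡ 1 (mod 4)`
    have hw3 : toZModPow 3 w = 1 := by
      have h := PadicInt.cast_toZModPow 3 (m + 1 + 2) (by omega) w
      rw [hw, ZMod.cast_one (show 2 ^ 3 ∣ 2 ^ (m + 1 + 2) from pow_dvd_pow 2 (by omega))] at h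
      exact h.symm
    obtain ⟨z, hz, hz1⟩ := exists_sq_eq_of_toZModPow_three_eq_one hw3
    -- `‖z − 1‖ ≤ 2^{−(m+2)}`
    have hwn : ‖w - 1‖ ≤ (2 : ℝ) ^ (-((m + 1 + 2 : ℕ) : ℤ)) :=
      (toZModPow_eq_iff_norm_sub_le _ w 1).mp (by rw [hw, map_one])
    have hzn : ‖z - 1‖ ≤ (2 : ℝ) ^ (-((m + 2 : ℕ) : ℤ)) := by
      have h := norm_sq_sub_one_of_norm_sub_one_lt hz1
      rw [hz, norm_two_padicInt] at h
      have h2 : ‖z - 1‖ = ‖w - 1‖ * 2 := by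
        rw [h]; ring
      rw [h2]
      calc ‖w - 1‖ * 2 ≤ (2 : ℝ) ^ (-((m + 1 + 2 : ℕ) : ℤ)) * 2 := by gcongr
        _ = (2 : ℝ) ^ (-((m + 2 : ℕ) : ℤ)) := by
          rw [show (-((m + 1 + 2 : ℕ) : ℤ)) = -((m + 2 : ℕ) : ℤ) - 1 by push_cast; ring,
            zpow_sub_one₀ (two_ne_zero)]
          ring
    have hzm : toZModPow (m + 2) z = 1 := by
      rw [← map_one (toZModPow (m + 2)), toZModPow_eq_iff_norm_sub_le]
      exact hzn
    obtain ⟨w₀, hw₀⟩ := ih hzm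
    exact ⟨w₀, by rw [pow_succ, pow_mul, hw₀, hz]⟩

/-- The units version: `w ∈ ℤ₂ˣ` with `w ≡ 1 (mod 2^{m+2})` is `w₀^{2^m}` for a unit `w₀`. [folklore] -/
theorem exists_units_pow_two_pow_eq_of_toZModPow_eq_one (m : ℕ) {w : ℤ_[2]ˣ}
    (hw : toZModPow (m + 2) (w : ℤ_[2]) = 1) : ∃ w₀ : ℤ_[2]ˣ, w₀ ^ 2 ^ m = w := by
  obtain ⟨z, hz⟩ := exists_pow_two_pow_eq_of_toZModPow_eq_one m hw
  have hzu : IsUnit z := by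
    have h2m : 2 ^ m ≠ 0 := pow_ne_zero m two_ne_zero
    exact (isUnit_pow_iff h2m).mp (hz ▸ w.isUnit)
  exact ⟨hzu.unit, Units.ext (by simp [hz])⟩

/-! ### The residue of `u^{2^m a}` modulo `2^{m+3}` for `u ≡ ±3 (mod 8)`, `a` odd -/

/-- For `u ≡ 3, 5 (mod 8)` and `a` odd, `u^a ≡ u (mod 8)`, written as `u^a ≡ ±5 = ±(1 + 4) (mod 8)`. [folklore] -/
theorem toZModPow_three_pow_odd_of_tateUnit {u : ℤ_[2]} (hu : toZModPow 3 u = 3 ∨ toZModPow 3 u = 5) {a : ℕ}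
    (ha : Odd a) :
    toZModPow 3 (u ^ a) = 1 + 2 ^ 2 ∨ toZModPow 3 (u ^ a) = -(1 + 2 ^ 2) := by
  obtain ⟨j, rfl⟩ := ha
  have key : ∀ t : ZMod (2 ^ 3), (t = 3 ∨ t = 5) → t ^ 2 = 1 := by decide
  rw [map_pow, pow_succ (toZModPow 3 u) (2 * j), pow_mul (toZModPow 3 u) 2 j, key _ hu, one_pow, one_mul]
  rcases hu with h | h <;> rw [h]
  · right; decide
  · left; decide

/-- **`u^{2^m a} ≡ ±(1 + 2^{m+2}) (mod 2^{m+3})`** for `u ≡ 3, 5 (mod 8)`, `a` odd, every `m ≥ 0` (the sign `−`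
occurs only for `m = 0`): induction on `m`, squaring `±(1 + 2^{m+2}) + 2^{m+3} t`. [folklore] -/
theorem toZModPow_pow_two_pow_mul_of_tateUnit {u : ℤ_[2]} (hu : toZModPow 3 u = 3 ∨ toZModPow 3 u = 5)
    {a : ℕ} (ha : Odd a) (m : ℕ) :
    toZModPow (m + 3) (u ^ (2 ^ m * a)) = 1 + 2 ^ (m + 2) ∨
      toZModPow (m + 3) (u ^ (2 ^ m * a)) = -(1 + 2 ^ (m + 2)) := by
  induction m with
  | zero => simpa using toZModPow_three_pow_odd_of_tateUnit hu ha
  | succ m ih =>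
    set U : ℤ_[2] := u ^ (2 ^ m * a) with hU
    have hsq : u ^ (2 ^ (m + 1) * a) = U ^ 2 := by
      rw [hU, ← pow_mul]; ring_nf
    -- `U = s (1 + 2^{m+2}) + 2^{m+3} t` with `s = ±1`
    obtain ⟨s, hs, hUs⟩ : ∃ s : ℤ_[2], (s = 1 ∨ s = -1) ∧
        toZModPow (m + 3) U = toZModPow (m + 3) (s * (1 + 2 ^ (m + 2))) := by
      rcases ih with h | h
      · exact ⟨1, Or.inl rfl, by rw [h, one_mul, map_add, map_one, map_pow, map_ofNat]⟩
      · exact ⟨-1, Or.inr rfl, by rw [h, neg_one_mul, map_neg, map_add, map_one, map_pow, map_ofNat]⟩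
    have hker : U - s * (1 + 2 ^ (m + 2)) ∈ RingHom.ker (toZModPow (p := 2) (m + 3)) := by
      rw [RingHom.mem_ker, map_sub, hUs, sub_self]
    rw [ker_toZModPow, Ideal.mem_span_singleton] at hker
    obtain ⟨t, ht⟩ := hker
    have hss : s ^ 2 = 1 := by rcases hs with rfl | rfl <;> norm_num
    -- `U² = 1 + 2^{m+3} + 2^{m+4}·(…)`
    have hU2 : U ^ 2 - (1 + 2 ^ (m + 3)) =
        (2 : ℤ_[2]) ^ (m + 4) * (2 ^ m + s * (1 + 2 ^ (m + 2)) * t + 2 ^ (m + 2) * t ^ 2) := by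
      have hUe : U = s * (1 + 2 ^ (m + 2)) + 2 ^ (m + 3) * t := by
        linear_combination ht
      rw [hUe]
      ring_nf
      rw [hss]
      ring
    have hker2 : U ^ 2 - (1 + 2 ^ (m + 3)) ∈ RingHom.ker (toZModPow (p := 2) (m + 1 + 3)) := by
      rw [ker_toZModPow, Ideal.mem_span_singleton, hU2, show m + 1 + 3 = m + 4 by ring]
      exact dvd_mul_right _ _
    rw [RingHom.mem_ker, map_sub, sub_eq_zero] at hker2
    left
    rw [hsq, hker2, show m + 1 + 2 = m + 3 by ring, map_add, map_one, map_pow, map_ofNat]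

/-- In `ℤ/2^{m+3}`: `1 + 2^{m+2} ≠ ±1` and `−(1 + 2^{m+2}) ≠ ±1`. [folklore] -/
theorem one_add_two_pow_ne_one_and_ne_neg_one (m : ℕ) :
    ((1 + 2 ^ (m + 2) : ZMod (2 ^ (m + 3))) ≠ 1 ∧ (1 + 2 ^ (m + 2) : ZMod (2 ^ (m + 3))) ≠ -1) ∧
      ((-(1 + 2 ^ (m + 2)) : ZMod (2 ^ (m + 3))) ≠ 1 ∧ (-(1 + 2 ^ (m + 2)) : ZMod (2 ^ (m + 3))) ≠ -1) := by
  have h1 : (2 ^ (m + 2) : ZMod (2 ^ (m + 3))) ≠ 0 := by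
    intro h
    have h' : ((2 ^ (m + 2) : ℕ) : ZMod (2 ^ (m + 3))) = 0 := by exact_mod_cast h
    rw [ZMod.natCast_eq_zero_iff] at h'
    have := Nat.le_of_dvd (by positivity) h'
    have hlt : 2 ^ (m + 2) < 2 ^ (m + 3) := Nat.pow_lt_pow_right (by norm_num) (by omega)
    omega
  have h2 : (2 + 2 ^ (m + 2) : ZMod (2 ^ (m + 3))) ≠ 0 := by
    intro h
    have h' : ((2 + 2 ^ (m + 2) : ℕ) : ZMod (2 ^ (m + 3))) = 0 := by exact_mod_cast h
    rw [ZMod.natCast_eq_zero_iff] at h'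
    have := Nat.le_of_dvd (by positivity) h'
    have hlt : 2 + 2 ^ (m + 2) < 2 ^ (m + 3) := by
      have h4 : 4 ≤ 2 ^ (m + 2) := by
        calc (4 : ℕ) = 2 ^ 2 := by norm_num
          _ ≤ 2 ^ (m + 2) := Nat.pow_le_pow_right (by norm_num) (by omega)
      have h5 : 2 ^ (m + 3) = 2 ^ (m + 2) * 2 := pow_succ 2 (m + 2)
      omega
    omega
  refine ⟨⟨fun h ↦ h1 (by linear_combination h), fun h ↦ h2 (by linear_combination h)⟩,
    ⟨fun h ↦ h2 (by linear_combination -h), fun h ↦ h1 (by linear_combination -h)⟩⟩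

/-- **`u^{2^m a} ≢ ±1 (mod 2^{m+3})`** for `u ∈ ℤ₂` with `u ≡ 3, 5 (mod 8)` and `a` odd — the unit part of
`q^{2^m a}`, `q = 2^k u` the Tate parameter, is NOT `≡ ±1 (mod 2^{m+3})`, i.e. `q^{2^m a}` lies outside
`⟨2⟩ · ±(1 + 2^{m+3}ℤ₂) = N(ℚ_{2,m+1}ˣ)`. [folklore] -/
theorem toZModPow_pow_ne_one_and_ne_neg_one_of_tateUnit {u : ℤ_[2]}
    (hu : toZModPow 3 u = 3 ∨ toZModPow 3 u = 5) {a : ℕ} (ha : Odd a) (m : ℕ) :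
    toZModPow (m + 3) (u ^ (2 ^ m * a)) ≠ 1 ∧ toZModPow (m + 3) (u ^ (2 ^ m * a)) ≠ -1 := by
  obtain ⟨⟨h1, h2⟩, ⟨h3, h4⟩⟩ := one_add_two_pow_ne_one_and_ne_neg_one m
  rcases toZModPow_pow_two_pow_mul_of_tateUnit hu ha m with h | h <;> rw [h]
  · exact ⟨h1, h2⟩
  · exact ⟨h3, h4⟩
/-! ### `ℚ₂ˣ = 2^ℤ × ℤ₂ˣ` and the index-`2^m` subgroup `⟨2⟩ · ±(1 + 2^{m+2}ℤ₂)` -/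

/-- `‖2^j‖ = 2^{−j}` in `ℚ₂`. [folklore] -/
theorem norm_two_zpow_padic (j : ℤ) : ‖(2 : ℚ_[2]) ^ j‖ = (2 : ℝ) ^ (-j) := by
  rw [norm_zpow, show ((2 : ℚ_[2]) = ((2 : ℕ) : ℚ_[2])) by norm_cast, Padic.norm_p]
  rw [show ((2 : ℕ) : ℝ)⁻¹ = (2 : ℝ) ^ (-1 : ℤ) by norm_num, ← zpow_mul]
  ring_nf

/-- **`ℚ₂ˣ = 2^ℤ · ℤ₂ˣ`**: every non-zero `x ∈ ℚ₂` is `2^j · w` with `j ∈ ℤ` and `w ∈ ℤ₂ˣ`. [folklore] -/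
theorem exists_eq_two_zpow_mul_units (x : ℚ_[2]) (hx : x ≠ 0) :
    ∃ (j : ℤ) (w : ℤ_[2]ˣ), x = (2 : ℚ_[2]) ^ j * ((w : ℤ_[2]) : ℚ_[2]) := by
  have h2 : (2 : ℚ_[2]) ≠ 0 := by norm_num
  set j : ℤ := x.valuation with hj
  have hw : ‖x * (2 : ℚ_[2]) ^ (-j)‖ = 1 := by
    rw [norm_mul, norm_two_zpow_padic, neg_neg, Padic.norm_eq_zpow_neg_valuation hx, ← hj,
      show (((2 : ℕ) : ℝ)) = (2 : ℝ) by norm_num, ← zpow_add₀ (by norm_num : (2 : ℝ) ≠ 0)]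
    simp
  refine ⟨j, PadicInt.mkUnits hw, ?_⟩
  rw [PadicInt.mkUnits_eq, mul_comm, mul_assoc, ← zpow_add₀ h2, neg_add_cancel, zpow_zero, mul_one]

/-- Uniqueness of `x = 2^j · w`: the exponent and the unit are determined. [folklore] -/
theorem two_zpow_mul_units_inj {j j' : ℤ} {w w' : ℤ_[2]ˣ}
    (h : (2 : ℚ_[2]) ^ j * ((w : ℤ_[2]) : ℚ_[2]) = (2 : ℚ_[2]) ^ j' * ((w' : ℤ_[2]) : ℚ_[2])) :
    j = j' ∧ w = w' := by
  have h2 : (2 : ℚ_[2]) ≠ 0 := by norm_num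
  have hn := congrArg (fun z : ℚ_[2] ↦ ‖z‖) h
  simp only [norm_mul, norm_two_zpow_padic] at hn
  rw [show ‖((w : ℤ_[2]) : ℚ_[2])‖ = 1 from PadicInt.norm_units w,
    show ‖((w' : ℤ_[2]) : ℚ_[2])‖ = 1 from PadicInt.norm_units w', mul_one, mul_one] at hn
  have hjj : j = j' := by
    have := zpow_right_injective₀ (by norm_num : (0 : ℝ) < 2) (by norm_num : (2 : ℝ) ≠ 1) hn
    linarith
  subst hjj
  refine ⟨rfl, ?_⟩
  have hw := mul_left_cancel₀ (zpow_ne_zero j h2) h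
  exact Units.ext (Subtype.ext hw)

/-- **The subgroup `T_m = ⟨2⟩ · ±(1 + 2^{m+2}ℤ₂)` of `ℚ₂ˣ` and its index `2^m`.** There is a subgroup of
`ℚ₂ˣ` whose elements are exactly the `2^j · w`, `j ∈ ℤ`, `w ∈ ℤ₂ˣ` with `w ≡ ±1 (mod 2^{m+2})`, and it has index
`2^m` (it is the kernel of `ℚ₂ˣ → ℤ₂ˣ → (ℤ/2^{m+2})ˣ/±1`, a surjection onto a group of order `2^{m+1}/2`). It is the
norm group of the `m`-th layer `ℚ₂(ζ_{2^{m+2}} + ζ⁻¹)` of the cyclotomic `ℤ₂`-extension (BRICK 14).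
[cite: NeukirchANT1999, Ch. II (5.7), Ch. V (1.1)] -/
theorem exists_subgroup_twoAdicLayerNorm (m : ℕ) :
    ∃ T : Subgroup ℚ_[2]ˣ,
      (∀ x : ℚ_[2]ˣ, x ∈ T ↔ ∃ (j : ℤ) (w : ℤ_[2]ˣ),
        (toZModPow (m + 2) (w : ℤ_[2]) = 1 ∨ toZModPow (m + 2) (w : ℤ_[2]) = -1) ∧
          (x : ℚ_[2]) = (2 : ℚ_[2]) ^ j * ((w : ℤ_[2]) : ℚ_[2])) ∧
      T.index = 2 ^ m := by
  have h2 : (2 : ℚ_[2]) ≠ 0 := by norm_num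
  -- the unit-part homomorphism `ℚ₂ˣ → ℤ₂ˣ`
  have hdec : ∀ x : ℚ_[2]ˣ, ∃ (j : ℤ) (w : ℤ_[2]ˣ), (x : ℚ_[2]) = (2 : ℚ_[2]) ^ j * ((w : ℤ_[2]) : ℚ_[2]) :=
    fun x ↦ exists_eq_two_zpow_mul_units (x : ℚ_[2]) x.ne_zero
  choose jv wv hjw using hdec
  let υ : ℚ_[2]ˣ →* ℤ_[2]ˣ :=
    { toFun := wv
      map_one' := by
        have h := hjw 1
        rw [Units.val_one, show (1 : ℚ_[2]) = (2 : ℚ_[2]) ^ (0 : ℤ) * (((1 : ℤ_[2]ˣ) : ℤ_[2]) : ℚ_[2])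
          by simp] at h
        exact (two_zpow_mul_units_inj h).2.symm
      map_mul' := fun x y ↦ by
        have h := hjw (x * y)
        rw [Units.val_mul, hjw x, hjw y, show (2 : ℚ_[2]) ^ jv x * ((wv x : ℤ_[2]) : ℚ_[2]) *
            ((2 : ℚ_[2]) ^ jv y * ((wv y : ℤ_[2]) : ℚ_[2])) =
            (2 : ℚ_[2]) ^ (jv x + jv y) * (((wv x * wv y : ℤ_[2]ˣ) : ℤ_[2]) : ℚ_[2]) by
          rw [zpow_add₀ h2]; push_cast; ring] at h
        exact (two_zpow_mul_units_inj h).2.symm }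
  have hυ : ∀ (x : ℚ_[2]ˣ) (j : ℤ) (w : ℤ_[2]ˣ),
      (x : ℚ_[2]) = (2 : ℚ_[2]) ^ j * ((w : ℤ_[2]) : ℚ_[2]) → υ x = w := by
    intro x j w h
    rw [hjw x] at h
    exact (two_zpow_mul_units_inj h).2
  -- reduction modulo `2^{m+2}` and the sign subgroup `{±1}`
  let ρ : ℤ_[2]ˣ →* (ZMod (2 ^ (m + 2)))ˣ := Units.map (toZModPow (p := 2) (m + 2)).toMonoidHom
  let N : Subgroup (ZMod (2 ^ (m + 2)))ˣ := (Units.map (Int.castRingHom (ZMod (2 ^ (m + 2)))).toMonoidHom).range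
  have hN : ∀ c : (ZMod (2 ^ (m + 2)))ˣ, c ∈ N ↔ (c : ZMod (2 ^ (m + 2))) = 1 ∨ (c : ZMod (2 ^ (m + 2))) = -1 := by
    intro c
    constructor
    · rintro ⟨e, rfl⟩
      rcases Int.units_eq_one_or e with rfl | rfl
      · left; simp
      · right; simp
    · rintro (h | h)
      · exact ⟨1, Units.ext (by simpa using h.symm)⟩
      · exact ⟨-1, Units.ext (by simpa using h.symm)⟩
  haveI : N.Normal := inferInstance
  let ψ : ℚ_[2]ˣ →* (ZMod (2 ^ (m + 2)))ˣ ⧸ N := (QuotientGroup.mk' N).comp (ρ.comp υ)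
  refine ⟨ψ.ker, fun x ↦ ?_, ?_⟩
  · -- membership
    rw [MonoidHom.mem_ker]
    change (QuotientGroup.mk' N) (ρ (υ x)) = 1 ↔ _
    rw [QuotientGroup.mk'_apply, QuotientGroup.eq_one_iff, hN]
    have hρ : ∀ w : ℤ_[2]ˣ, ((ρ w : (ZMod (2 ^ (m + 2)))ˣ) : ZMod (2 ^ (m + 2))) =
        toZModPow (m + 2) (w : ℤ_[2]) := fun w ↦ rfl
    rw [hρ]
    constructor
    · intro h
      exact ⟨jv x, υ x, h, hjw x⟩
    · rintro ⟨j, w, hw, hx⟩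
      rwa [hυ x j w hx]
  · -- index
    have hsurj : Function.Surjective ψ := by
      intro c
      obtain ⟨c, rfl⟩ := QuotientGroup.mk_surjective c
      -- lift `c` to an odd natural number
      set n : ℕ := (c : ZMod (2 ^ (m + 2))).val with hn
      have hnodd : ¬ 2 ∣ n := by
        intro hd
        have hu : IsUnit ((n : ZMod (2 ^ (m + 2)))) := by
          rw [hn, ZMod.natCast_zmod_val]; exact c.isUnit
        have h2u : IsUnit ((2 : ZMod (2 ^ (m + 2)))) := by
          obtain ⟨k, hk⟩ := hd
          rw [hk, Nat.cast_mul, Nat.cast_ofNat] at hu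
          exact isUnit_of_mul_isUnit_left hu
        have hnot : ¬ IsUnit ((2 : ZMod (2 ^ (m + 2)))) := by
          rw [show (2 : ZMod (2 ^ (m + 2))) = ((2 : ℕ) : ZMod (2 ^ (m + 2))) by norm_cast,
            ZMod.isUnit_iff_coprime]
          rw [Nat.coprime_pow_right_iff (by omega : 0 < m + 2), Nat.coprime_self]
          norm_num
        exact hnot h2u
      have hwn : ‖((n : ℤ) : ℤ_[2])‖ = 1 := by
        refine le_antisymm (PadicInt.norm_le_one _) ?_
        by_contra hlt
        rw [not_le, PadicInt.norm_int_lt_one_iff_dvd] at hlt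
        exact hnodd (by exact_mod_cast hlt)
      let w : ℤ_[2]ˣ := PadicInt.mkUnits (u := ((n : ℤ) : ℚ_[2])) (by
        rw [show (((n : ℤ) : ℚ_[2])) = (((n : ℤ) : ℤ_[2]) : ℚ_[2]) by norm_cast]; exact hwn)
      have hw0 : ((w : ℤ_[2]) : ℚ_[2]) ≠ 0 := by
        rw [PadicInt.mkUnits_eq]; exact_mod_cast fun h ↦ hnodd (by rw [h]; exact dvd_zero 2)
      let x : ℚ_[2]ˣ := Units.mk0 _ hw0
      refine ⟨x, ?_⟩
      have hx : υ x = w := hυ x 0 w (by simp [x])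
      change (QuotientGroup.mk' N) (ρ (υ x)) = _
      rw [hx, QuotientGroup.mk'_apply]
      congr 1
      apply Units.ext
      change toZModPow (m + 2) (w : ℤ_[2]) = (c : ZMod (2 ^ (m + 2)))
      have hwval : (w : ℤ_[2]) = ((n : ℤ) : ℤ_[2]) := by
        apply Subtype.ext
        rw [PadicInt.mkUnits_eq]
        norm_cast
      rw [hwval, map_intCast, Int.cast_natCast, hn, ZMod.natCast_zmod_val]
    -- counting: `#(ℤ/2^{m+2})ˣ = 2^{m+1}`, `#N = 2`
    haveI : Fact (1 < 2 ^ (m + 2)) := ⟨Nat.one_lt_pow (by omega) (by norm_num)⟩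
    haveI : Fact (2 < 2 ^ (m + 2)) := ⟨by
      calc (2 : ℕ) < 2 ^ 2 := by norm_num
        _ ≤ 2 ^ (m + 2) := Nat.pow_le_pow_right (by norm_num) (by omega)⟩
    have hcardG : Nat.card (ZMod (2 ^ (m + 2)))ˣ = 2 ^ (m + 1) := by
      rw [Nat.card_eq_fintype_card, ZMod.card_units_eq_totient, Nat.totient_prime_pow Nat.prime_two (by omega)]
      simp
    have hcardN : Nat.card N = 2 := by
      have hNeq : (N : Set (ZMod (2 ^ (m + 2)))ˣ) = {1, -1} := by
        ext c
        rw [SetLike.mem_coe, hN, Set.mem_insert_iff, Set.mem_singleton_iff]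
        constructor
        · rintro (h | h)
          · left; exact Units.ext (by simpa using h)
          · right; exact Units.ext (by simpa using h)
        · rintro (rfl | rfl)
          · left; simp
          · right; simp
      rw [← SetLike.coe_sort_coe, hNeq, Nat.card_coe_set_eq, Set.ncard_pair]
      intro h
      have h' := congrArg (fun c : (ZMod (2 ^ (m + 2)))ˣ ↦ (c : ZMod (2 ^ (m + 2)))) h
      simp only [Units.val_one, Units.val_neg] at h'
      exact ZMod.neg_one_ne_one h'.symm
    have hquot : Nat.card ((ZMod (2 ^ (m + 2)))ˣ ⧸ N) = 2 ^ m := by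
      have h := Subgroup.card_eq_card_quotient_mul_card_subgroup N
      rw [hcardG, hcardN, pow_succ] at h
      linarith
    rw [Subgroup.index_ker, MonoidHom.range_eq_top.mpr hsurj, Subgroup.card_top, hquot]

end Summit.BirchSwinnertonDyer.BirchSwinnertonDyer.Theorems.MultTowerNS2

end
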